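import Literature.Computability.Cryptography.PeriodFindingInputBlock
import Literature.Computability.Cryptography.PeriodFindingFamily
import Literature.Computability.Complexity.SplitOnesBricks
import Literature.Computability.Complexity.LengthCompare
import Literature.Computability.Complexity.CodeFPStrings
import Literature.Computability.Complexity.StackWords
import HarnessLib

/-!
# Period finding of an input-dependent table: the table-bit oracle language in `P`

Topic `Computability/Cryptography`; continues `PeriodFindingInputBlock/Family.lean`. The
input-reading quantum core queries an oracle on `xs ++ 1ⁿ 0 1ʲ 0 ++ bits_L(v)` (input `xs` of length
`n`, query index `j`, offset value `v` on `L` little-endian bits) and records, per unit `u`, the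
answer tuple `FuI A xs u v = ([…query j… ∈ A])_{j < L_u}`. For an application whose table is a
polynomial-time function `tab x v` of the ORIGINAL input `x` and of the offset (Hallgren's walk,
`InfrastructureWalkFP.codeFP_tableI`; generally any `P`-computable table), this file supplies the
oracle language and its properties:

* the core input is the self-delimited copy `⟨x, ε⟩ = boolPair x []` of `x` (a pre-processor in
  `FP` for `isQSolvable_classicalWrap`), so that the query `boolPair x [] ++ hdr n j bits` parses
  uniquely (`boolUnpair`, `SplitOnesBricks.afterZeroFn/onesPrefixFn`);
* `tabBit tab w` — the total decider: parse `(x, j, bits)` and return bit `j` of the END-MARKED code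
  `tab x (bitsToNat bits) ++ [1]`; **`tabBit_query`** (its value on a genuine query);
  `tabLang tab = {w | tabBit w}`, **`tabLang_mem_P`** (from a `CodeFP` program for `tab`);
* **`FuI_tabLang`** — the answer tuple of unit `u` at `v < 2^{L_u}` is the first `L_u` bits of
  `tab x v ++ [1]`, and **`FuI_tabLang_inj`** — it determines `tab x v` whenever `|tab x v| < L_u`
  (the end marker makes zero-padding injective), so the level sets of the unit's table are those
  of `v ↦ tab x v`.

## References

* E. Bernstein, U. Vazirani, SIAM J. Comput. 26 (1997), §8.3 (oracle queries `|x·b⟩ ↦ |x·(b ⊕ f(x))⟩`)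
  [BernsteinVazirani1997SICOMP].
* S. Arora, B. Barak, *Computational Complexity: A Modern Approach*, CUP 2009, §0.1 (pairing),
  §1.3 [AroraBarak2009].
* S. Hallgren, J. ACM 54 (2007), Art. 4, §4 [Hallgren2007].
-/

noncomputable section

namespace Literature.Computability.Cryptography

namespace PeriodFinding

open _root_.Computability Complexity Complexity.CodeFP Complexity.Brick Finset Function

variable (tab : List Bool → ℕ → List Bool)

/-! ### The decider and the language -/

/-- **The table-bit decider**: parse `⟨x, 1ⁿ 0 1ʲ 0 bits⟩` and return bit `j` of `tab x (val bits) ++ [1]`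
(junk parses give junk bits; only genuine queries matter). [cite: BernsteinVazirani1997SICOMP, §8.3] -/
def tabBit (w : List Bool) : Bool :=
  (tab (boolUnpair w).1 (bitsToNat (afterZeroFn (afterZeroFn (boolUnpair w).2))) ++ [true]).getD
    (splitOnes (afterZeroFn (boolUnpair w).2)).1 false

/-- **The table-bit language.** [cite: BernsteinVazirani1997SICOMP, §8.3] -/
def tabLang : Language Bool := {w | tabBit tab w = true}

/-- The indicator of the language is the decider. [folklore] -/
theorem boolIndicator_tabLang (w : List Bool) : (tabLang tab).boolIndicator w = tabBit tab w := by
  unfold tabLang Set.boolIndicator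
  by_cases h : tabBit tab w = true
  · rw [if_pos (show w ∈ {w | tabBit tab w = true} from h), h]
  · rw [if_neg (show w ∉ {w | tabBit tab w = true} from h)]
    cases hb : tabBit tab w
    · rfl
    · exact absurd hb h

/-- `⟨x, ε⟩ ++ r = ⟨x, r⟩`. [cite: AroraBarak2009, §0.1] -/
theorem boolPair_nil_append (x r : List Bool) : boolPair x [] ++ r = boolPair x r := by
  simp [boolPair]

/-- **The decider on a genuine query**: `tabBit (⟨x, ε⟩ ++ 1ⁿ 0 1ʲ 0 bits) = (tab x (val bits) ++ [1])[j]`.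
[cite: BernsteinVazirani1997SICOMP, §8.3] -/
theorem tabBit_query (x : List Bool) (n j : ℕ) (bits : List Bool) :
    tabBit tab (boolPair x [] ++ hdr n j bits) = (tab x (bitsToNat bits) ++ [true]).getD j false := by
  rw [boolPair_nil_append, tabBit, boolUnpair_boolPair]
  simp only [hdr]
  rw [show afterZeroFn (ones n ++ false :: (ones j ++ false :: bits)) = ones j ++ false :: bits from
    afterZeroFn_ones_append n _, afterZeroFn_ones_append, splitOnes_ones_append]

/-! ### The answer tuples of the units -/

/-- Little-endian bits of a number below `2^L` evaluate back to it. [folklore] -/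
theorem bitsToNat_ofFn_testBit {L v : ℕ} (hv : v < 2 ^ L) :
    bitsToNat (List.ofFn fun i : Fin L => v.testBit i) = v := by
  apply Nat.eq_of_testBit_eq
  intro i
  rw [testBit_bitsToNat_eq_getD, List.getD_eq_getElem?_getD, List.getElem?_ofFn]
  by_cases hi : i < L
  · simp [hi]
  · simp only [hi, dite_false, Option.getD_none]
    symm
    apply Nat.testBit_eq_false_of_lt
    exact hv.trans_le (Nat.pow_le_pow_right (by norm_num) (not_lt.mp hi))

/-- **The answer tuple of unit `u` at an offset value `v < 2^{L_u}`** is the first `L_u` bits of the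
end-marked table code. [cite: Hallgren2007, §4] -/
theorem FuI_tabLang (P : FParams) (x : List Bool) (u : Fin (nU P (boolPair x []).length)) {v : ℕ}
    (hv : v < 2 ^ (spec P (boolPair x []).length).L u) :
    FuI (spec P (boolPair x []).length) (tabLang tab) (boolPair x []) u v =
      List.ofFn fun j : Fin ((spec P (boolPair x []).length).L u) => (tab x v ++ [true]).getD j false := by
  unfold FuI
  refine List.ofFn_inj.mpr (funext fun j => ?_)
  have hj : (j : ℕ) < Ltop P (boolPair x []).length := lt_trans j.isLt (Lof_lt_Ltop P _ u)
  rw [boolIndicator_tabLang, show (spec P (boolPair x []).length).cpre j = cpre P (boolPair x []).length j from rfl,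
    cpre_append P _ hj, tabBit_query, bitsToNat_ofFn_testBit hv]

/-- Zero-padded end-marked codes are injective below the padding length. [folklore] -/
theorem ofFn_getD_append_true_inj {s t : List Bool} {L : ℕ} (hs : s.length < L) (ht : t.length < L)
    (h : (List.ofFn fun j : Fin L => (s ++ [true]).getD j false) =
      List.ofFn fun j : Fin L => (t ++ [true]).getD j false) : s = t := by
  have key : ∀ j < L, (s ++ [true]).getD j false = (t ++ [true]).getD j false := by
    intro j hj
    have := congrFun (List.ofFn_inj.mp h) ⟨j, hj⟩
    exact this
  -- the two end-marked strings agree on all positions `< L`, and both have length `≤ L`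
  have hlen : (s ++ [true]).length = (t ++ [true]).length := by
    by_contra hne
    rcases Nat.lt_or_gt_of_ne hne with hlt | hlt
    · -- position `|s|` : `s ++ [1]` has `1`... no: position `|t|`: `t ++ [1]` has `1`, `s ++ [1]` is past the end or inside
      have h1 := key t.length (by omega)
      rw [List.getD_eq_getElem?_getD, List.getD_eq_getElem?_getD,
        List.getElem?_eq_none (by simp at hlt ⊢; omega)] at h1
      simp at h1
    · have h1 := key s.length (by omega)
      rw [List.getD_eq_getElem?_getD, List.getD_eq_getElem?_getD,
        List.getElem?_eq_none (l := t ++ [true]) (by simp at hlt ⊢; omega)] at h1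
      simp at h1
  have hst : s ++ [true] = t ++ [true] := by
    apply List.ext_getElem hlen
    intro j h1 h2
    have := key j (by simp at h1; omega)
    rw [List.getD_eq_getElem?_getD, List.getD_eq_getElem?_getD, List.getElem?_eq_getElem h1,
      List.getElem?_eq_getElem h2] at this
    simpa using this
  exact List.append_cancel_right hst

/-- **The answer tuple determines the table value** when the code is shorter than the block:
level sets of the unit's table are level sets of `v ↦ tab x v`. [cite: Hallgren2007, §4] -/
theorem FuI_tabLang_inj (P : FParams) (x : List Bool) (u : Fin (nU P (boolPair x []).length)) {v v' : ℕ}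
    (hv : v < 2 ^ (spec P (boolPair x []).length).L u) (hv' : v' < 2 ^ (spec P (boolPair x []).length).L u)
    (hl : (tab x v).length < (spec P (boolPair x []).length).L u)
    (hl' : (tab x v').length < (spec P (boolPair x []).length).L u) :
    FuI (spec P (boolPair x []).length) (tabLang tab) (boolPair x []) u v =
        FuI (spec P (boolPair x []).length) (tabLang tab) (boolPair x []) u v' ↔ tab x v = tab x v' := by
  rw [FuI_tabLang tab P x u hv, FuI_tabLang tab P x u hv']
  exact ⟨ofFn_getD_append_true_inj hl hl', fun h => by rw [h]⟩

/-! ### The language is in `P` -/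

/-- **The decider on codes.** [cite: AroraBarak2009, §1.3] -/
theorem codeFP_tabBit (htab : CodeFP (pairE strE natE) strE (fun p => tab p.1 p.2)) :
    CodeFP strE bitE (tabBit tab) := by
  have h1 : CodeFP strE strE (fun w => (boolUnpair w).1) := ⟨fstF, fstF_mem_FP, fun _ => rfl⟩
  have h2 : CodeFP strE strE (fun w => (boolUnpair w).2) := ⟨sndF, sndF_mem_FP, fun _ => rfl⟩
  have haz : CodeFP strE strE afterZeroFn := ⟨afterZeroFn, afterZeroFn_mem_FP, fun _ => rfl⟩
  have hlead : CodeFP strE unE (fun w => (splitOnes w).1) :=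
    ⟨onesPrefixFn, onesPrefixFn_mem_FP, fun w => by rw [unE_eq_ones]; rfl⟩
  have hr : CodeFP strE strE (fun w => afterZeroFn (boolUnpair w).2) := haz.comp h2
  have hj : CodeFP strE unE (fun w => (splitOnes (afterZeroFn (boolUnpair w).2)).1) := hlead.comp hr
  have hv : CodeFP strE natE (fun w => bitsToNat (afterZeroFn (afterZeroFn (boolUnpair w).2))) :=
    strVal.comp (haz.comp hr)
  have ht : CodeFP strE strE (fun w => tab (boolUnpair w).1 (bitsToNat (afterZeroFn (afterZeroFn (boolUnpair w).2))) ++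
      [true]) :=
    (strAppend.comp ((htab.comp (h1.pair hv)).pair (const _ [true])) :)
  exact (strGetD.comp (hj.pair ht)).congr fun _ => rfl

/-- **The table-bit language is in `P`** when the table is a `CodeFP` program. [cite: AroraBarak2009, Def. 1.13] -/
theorem tabLang_mem_P (htab : CodeFP (pairE strE natE) strE (fun p => tab p.1 p.2)) : tabLang tab ∈ Classes.P := by
  obtain ⟨g, hg, hgt⟩ := codeFP_tabBit tab htab
  refine mem_P_of_mem_FP hg (tabLang tab) fun w => ⟨fun hw => ?_, fun hw => ?_⟩
  · rw [show g w = bitE (tabBit tab w) from hgt w, show tabBit tab w = true from hw]; rfl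
  · rw [show g w = bitE (tabBit tab w) from hgt w]
    have : tabBit tab w = false := by
      cases h : tabBit tab w
      · rfl
      · exact absurd h hw
    rw [this]; rfl

end PeriodFinding

end Literature.Computability.Cryptography

end
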